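import Summits.QuantumFields.YangMills.Theorems.SwapVirialDeficitSwapRingSectorVolumes
import HarnessLib

/-!
# The σ-glued ring: SECTOR TRIAGE at ring level — odd seam classes are void near the valley, `z 2 = 1` classes are subleading by `√u`
# (sector triage (C-b)/(C-c) for the sharp fixed-`L` σ-law — BC5 rung `stub_rung_fixedL` of LINE «sharp-sigma» on ⟨stmt-QuantumFields-24197⟩
# `SwapVirialDeficit.SwapGluedStiffness`; LEAD ym-line-sfw-p2 g93's programme; free-hands support of ⟨24197⟩)

The four-leader events of the eight seam sectors are not on the same footing (w2 g54's (B-iii)/(B-iv), fcl-p3 g43's ✓`SwapRingSectors`):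
* §1 a LAPLACE LEMMA WITH A SQUARE ROOT: `μ{F ≤ s} ≤ C·s^N·√s` on `(0,u₀]` ⇒ `∫e^{−βF}dμ ≤ C(N! + (N+1)!)/(2β^N√β) + u₀^{−(N+1)}(N+1)!/β^{N+1}`
  (layer cake and `√s ≤ (βs + 1)/(2√β)`, no Gamma function at half-integers);
* §2 the ODD classes `z 0 ≠ z 1`: ★★ `swap_oddSector_measure_eq_zero` — `μ_L{F^S_z ≤ u} = 0` for `u ≤ u₀(L)` (the signed four-leader event is EMPTY,
  ✓`haar_signedEvent_odd(')_eq_zero`, through ✓`swapBox_of_swapRingDeficit_le` and ✓`ringMeasure_real_swapDeficit_le_le_box_of_box`), hence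
  ★★ `swap_oddSector_integral_exp_le` — `∫e^{−bF^S_z}dμ_L ≤ e^{−b·u₀}` for every `b ≥ 0`: exponentially negligible against `β^{−(9L⁴−1)}`;
* §3 the classes `z 2 = 1`: ★★ `swap_minusSector_volume_le` — `μ_L{F^S_z ≤ u} ≤ C_L·u^{9L⁴−1}·√u` on `(0,u₀]` (w2's `t⁸`: `8 + 3(6L⁴−3) = 2(9L⁴−1) + 1`),
  hence ★★ `swap_minusSector_integral_exp_le` — `∫e^{−βF^S_z}dμ_L ≤ K_L/(β^{9L⁴−1}√β) + K'_L/β^{9L⁴}` for every `β > 0`: subleading by `√β`.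
With ✓`SwapRing.twistTrace_eq_quarter_sum_filter` (pairing `z ↦ z + (1,1,0)`) the fixed-`L` leading term of `Z^S_{L,β}` is carried by the single class
`{000, 110}`, i.e. `Z^S = (1/4)e^{12βL⁴}(2∫e^{−βF^S_0} + O_L(β^{−(9L⁴−1)−1/2}))` — the sharp law is needed for ONE sector deficit `F^S_0`.
HONEST LABEL: fixed-`L` measure bookkeeping toward a plan-only BC5 rung of a DRAFT line; ⟨24197⟩/⟨24194⟩/⟨24497⟩/⟨24196⟩ stay OPEN; the Yang–Mills
mass gap is NOT proved; no summit is proved by a line.  Width seat ym-line-sfw-p2-w2 g55 (cell ym-idea-1, free hands; own crux ⟨22884⟩ blocked-on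
⟨19935⟩), `--supports stmt-QuantumFields-24197`.  THEOREMS ONLY (0 `def`, 0 `sorry`), standard axioms.
References: [cite: tHooft1979]; [cite: Luscher1983, §2]; [cite: Chatterjee2016, Lemma 9.3]; [folklore].
-/

set_option autoImplicit false

noncomputable section

open MeasureTheory Set
open scoped BigOperators ENNReal Nat
open Literature.MathematicalPhysics.QuantumFieldTheory hiding SU2
open Literature.MathematicalPhysics.QuantumLattice

namespace Summit.QuantumFields.YangMills.Theorems.SwapVirialDeficit.SwapRing

open Summit.QuantumFields.YangMills.Theorems.FemtoTransferGap
open Summit.QuantumFields.YangMills.Theorems.FemtoTransferGap.TT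
open Summit.QuantumFields.YangMills.Theorems.VirialFluxGap.RingDeficit
open Summit.QuantumFields.YangMills.Theorems.TwistEaterVolume.Tauber
open Summit.QuantumFields.YangMills.Theorems.SwapTwistDeficit.ToronLog (coneConst coneConst_pos)
open Summit.QuantumFields.YangMills.Theorems.ToronValleyVolume.PeriodicRingCeiling (ballVol_le_four_mul_cube)
open Summit.QuantumFields.YangMills.Theorems.SwapVirialDeficit.SwapRingTwisted (swapBox_of_swapRingDeficit_le)
open Summit.QuantumFields.YangMills.Theorems.SwapVirialDeficit.SwapRingSectors
  (haar_signedEvent_minus_le haar_signedEvent_odd_eq_zero haar_signedEvent_odd'_eq_zero)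

/-! ## §1 A log-free Laplace ceiling with a square-root gain -/

section Laplace

variable {Ω : Type*} [MeasurableSpace Ω] {μ : Measure Ω} [IsProbabilityMeasure μ]

/-- `√s ≤ (βs + 1)/(2√β)` for `s ≥ 0`, `β > 0` (AM–GM for `√(βs)·1`). [folklore] -/
theorem sqrt_le_linear_div {s β : ℝ} (hs : 0 ≤ s) (hβ : 0 < β) : Real.sqrt s ≤ (β * s + 1) / (2 * Real.sqrt β) := by
  have hb : 0 < Real.sqrt β := Real.sqrt_pos.2 hβ
  rw [le_div_iff₀ (by positivity)]
  have hsq : Real.sqrt β * Real.sqrt s = Real.sqrt (β * s) := (Real.sqrt_mul hβ.le s).symm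
  have hx : 0 ≤ Real.sqrt (β * s) := Real.sqrt_nonneg _
  have hx2 : Real.sqrt (β * s) ^ 2 = β * s := Real.sq_sqrt (by positivity)
  nlinarith [sq_nonneg (Real.sqrt (β * s) - 1), hsq]

/-- ★ **Laplace ceiling with a square root**: if `μ{F ≤ s} ≤ C·s^N·√s` for `0 < s ≤ u₀` (probability measure, `F ≥ 0` measurable), then for every `β > 0`
`∫e^{−βF}dμ ≤ C·(N! + (N+1)!)/(2·β^N·√β) + u₀^{−(N+1)}·(N+1)!/β^{N+1}` — layer cake, `√s ≤ (βs+1)/(2√β)` on `(0,u₀]` and `1 ≤ (s/u₀)^{N+1}` beyond.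
[folklore] -/
theorem integral_exp_neg_mul_le_of_pow_sqrt_volume (F : Ω → ℝ) (hF : Measurable F) (hF0 : ∀ ω, 0 ≤ F ω) {C u₀ : ℝ} (hC : 0 ≤ C)
    (hu₀ : 0 < u₀) (N : ℕ) (hvol : ∀ s : ℝ, 0 < s → s ≤ u₀ → μ.real {ω | F ω ≤ s} ≤ C * s ^ N * Real.sqrt s) {β : ℝ} (hβ : 0 < β) :
    ∫ ω, Real.exp (-(β * F ω)) ∂μ ≤
      C * (N ! + (N + 1) !) / (2 * β ^ N * Real.sqrt β) + (u₀ ^ (N + 1))⁻¹ * (N + 1) ! / β ^ (N + 1) := by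
  rw [integral_exp_neg_mul_eq_integral_sublevel F hF hF0 hβ]
  have hb : 0 < Real.sqrt β := Real.sqrt_pos.2 hβ
  -- the two coefficients of the dominating polynomial `A·s^N + B·s^{N+1}`
  set A : ℝ := C / (2 * Real.sqrt β) with hA
  set B : ℝ := C * β / (2 * Real.sqrt β) + (u₀ ^ (N + 1))⁻¹ with hB
  have hA0 : 0 ≤ A := by positivity
  have hB0 : 0 ≤ B := by positivity
  -- pointwise domination of the layer-cake integrand
  have hpt : ∀ s ∈ Ioi (0 : ℝ), β * Real.exp (-(β * s)) * μ.real {ω | F ω ≤ s} ≤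
      A * β * (s ^ N * Real.exp (-(β * s))) + B * β * (s ^ (N + 1) * Real.exp (-(β * s))) := by
    intro s hs
    have hs0 : 0 < s := hs
    have hvol' : μ.real {ω | F ω ≤ s} ≤ A * s ^ N + B * s ^ (N + 1) := by
      rcases le_or_gt s u₀ with h | h
      · have h1 := hvol s hs0 h
        have h2 : C * s ^ N * Real.sqrt s ≤ C * s ^ N * ((β * s + 1) / (2 * Real.sqrt β)) :=
          mul_le_mul_of_nonneg_left (sqrt_le_linear_div hs0.le hβ) (by positivity)
        have h3 : C * s ^ N * ((β * s + 1) / (2 * Real.sqrt β)) = A * s ^ N + C * β / (2 * Real.sqrt β) * s ^ (N + 1) := by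
          rw [hA]; field_simp; ring
        have h4 : C * β / (2 * Real.sqrt β) * s ^ (N + 1) ≤ B * s ^ (N + 1) := by
          rw [hB]
          have : 0 ≤ (u₀ ^ (N + 1))⁻¹ * s ^ (N + 1) := by positivity
          nlinarith
        linarith
      · have h1 : (1 : ℝ) ≤ (s / u₀) ^ (N + 1) := one_le_pow₀ (by rw [le_div_iff₀ hu₀]; linarith)
        rw [div_pow, div_eq_mul_inv, mul_comm] at h1
        have h4 : (u₀ ^ (N + 1))⁻¹ * s ^ (N + 1) ≤ B * s ^ (N + 1) := by
          rw [hB]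
          have : 0 ≤ C * β / (2 * Real.sqrt β) * s ^ (N + 1) := by positivity
          nlinarith
        have h5 : 0 ≤ A * s ^ N := by positivity
        calc μ.real {ω | F ω ≤ s} ≤ 1 := measureReal_le_one
          _ ≤ A * s ^ N + B * s ^ (N + 1) := by linarith
    have hw : 0 ≤ β * Real.exp (-(β * s)) := by positivity
    calc β * Real.exp (-(β * s)) * μ.real {ω | F ω ≤ s} ≤ β * Real.exp (-(β * s)) * (A * s ^ N + B * s ^ (N + 1)) :=
        mul_le_mul_of_nonneg_left hvol' hw
      _ = A * β * (s ^ N * Real.exp (-(β * s))) + B * β * (s ^ (N + 1) * Real.exp (-(β * s))) := by ring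
  have hint1 := integrableOn_mul_exp_neg_mul_mul_sublevel (μ := μ) F hβ
  have hint2 : IntegrableOn (fun s : ℝ => A * β * (s ^ N * Real.exp (-(β * s))) + B * β * (s ^ (N + 1) * Real.exp (-(β * s)))) (Ioi 0) :=
    ((integrableOn_pow_mul_exp_neg_mul_Ioi N hβ).const_mul _).add ((integrableOn_pow_mul_exp_neg_mul_Ioi (N + 1) hβ).const_mul _)
  calc ∫ s in Ioi (0 : ℝ), β * Real.exp (-(β * s)) * μ.real {ω | F ω ≤ s}
      ≤ ∫ s in Ioi (0 : ℝ), (A * β * (s ^ N * Real.exp (-(β * s))) + B * β * (s ^ (N + 1) * Real.exp (-(β * s)))) :=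
        setIntegral_mono_on hint1 hint2 measurableSet_Ioi hpt
    _ = A * β * (N ! / β ^ (N + 1)) + B * β * ((N + 1) ! / β ^ (N + 1 + 1)) := by
        rw [integral_add ((integrableOn_pow_mul_exp_neg_mul_Ioi N hβ).const_mul _)
          ((integrableOn_pow_mul_exp_neg_mul_Ioi (N + 1) hβ).const_mul _), integral_const_mul, integral_const_mul,
          integral_pow_mul_exp_neg_mul_Ioi N hβ, integral_pow_mul_exp_neg_mul_Ioi (N + 1) hβ]
    _ = C * (N ! + (N + 1) !) / (2 * β ^ N * Real.sqrt β) + (u₀ ^ (N + 1))⁻¹ * (N + 1) ! / β ^ (N + 1) := by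
        rw [hA, hB]
        field_simp
        ring

end Laplace

variable {L : ℕ} [NeZero L]

/-! ## §2 The odd classes `z 0 ≠ z 1`: void near the valley -/

/-- ★★ **Odd seam sectors carry NO mass near the σ-flat valley**: for `z 0 ≠ z 1` there is `u₀(L) > 0` with `μ_L{F^S_z ≤ u} = 0` for all `u ≤ u₀` —
on `{F^S_z ≤ u}` the four leaders lie in the signed event `E^F_z(52L³√u)` (✓`swapBox_of_swapRingDeficit_le`), which is EMPTY for `52L³√u < t₀`
(✓`haar_signedEvent_odd(')_eq_zero`, i.e. w2 g54's ✓`sigmaTwisted_odd_empty(')`). [cite: tHooft1979] [cite: Luscher1983, §2] -/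
theorem swap_oddSector_measure_eq_zero (z : Fin 3 → Bool) (h01 : z 0 ≠ z 1) :
    ∃ u₀ : ℝ, 0 < u₀ ∧ ∀ u : ℝ, u ≤ u₀ → (ringMeasure L) {P | swapRingDeficit L z P ≤ u} = 0 := by
  haveI := isProbabilityMeasure_ringMeasure (L := L)
  -- the odd four-leader event vanishes below `t₀`
  obtain ⟨t₀, ht₀, hE⟩ : ∃ t₀ : ℝ, 0 < t₀ ∧ ∀ t : ℝ, t < t₀ →
      (Measure.pi fun _ : Fin 4 => haarProbability SU2) {C : Fin 4 → SU2 |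
        (∀ μ ν : Fin 3, frobNorm (((C (Fin.castSucc μ) * C (Fin.castSucc ν) : SU2) : Matrix (Fin 2) (Fin 2) ℂ) -
          ((C (Fin.castSucc ν) * C (Fin.castSucc μ) : SU2) : Matrix (Fin 2) (Fin 2) ℂ)) ≤ t) ∧
        ∀ μ : Fin 3, frobNorm (((C (Fin.last 3) * C (Fin.castSucc (Equiv.swap (0 : Fin 3) 1 μ)) : SU2) : Matrix (Fin 2) (Fin 2) ℂ) -
          ((centreElem (z μ) * C (Fin.castSucc μ) * C (Fin.last 3) : SU2) : Matrix (Fin 2) (Fin 2) ℂ)) ≤ t} = 0 := by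
    cases h0 : z 0 <;> cases h1 : z 1
    · exact absurd (h0.trans h1.symm) h01
    · exact haar_signedEvent_odd'_eq_zero z h0 h1
    · exact haar_signedEvent_odd_eq_zero z h0 h1
    · exact absurd (h0.trans h1.symm) h01
  have hL : (0 : ℝ) < L := Nat.cast_pos.2 (NeZero.pos L)
  have hA : (0 : ℝ) < 52 * (L : ℝ) ^ 3 := by positivity
  -- the threshold `u₀ = (t₀/(104L³))²`: then `52L³√u ≤ t₀/2 < t₀`
  refine ⟨(t₀ / (104 * (L : ℝ) ^ 3)) ^ 2, by positivity, fun u hu => ?_⟩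
  have hsub : {P | swapRingDeficit L z P ≤ u} ⊆ {P | swapRingDeficit L z P ≤ (t₀ / (104 * (L : ℝ) ^ 3)) ^ 2} :=
    fun P hP => le_trans hP hu
  refine measure_mono_null hsub ?_
  set u₀ : ℝ := (t₀ / (104 * (L : ℝ) ^ 3)) ^ 2 with hu₀_def
  have hs : 52 * (L : ℝ) ^ 3 * Real.sqrt u₀ < t₀ := by
    rw [hu₀_def, Real.sqrt_sq (by positivity)]
    have : 52 * (L : ℝ) ^ 3 * (t₀ / (104 * (L : ℝ) ^ 3)) = t₀ / 2 := by field_simp; ring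
    rw [this]; linarith
  have hF := ringMeasure_real_swapDeficit_le_le_box_of_box (L := L) z
    (fun x : Site 3 L => centreElem (Bool.xor (z 0 && decide (x 0 ≠ 0)) (Bool.xor (z 1 && decide (x 1 ≠ 0)) (z 2 && decide (x 2 ≠ 0)))))
    (fun μ : Fin 3 => centreElem (z μ)) (s := 52 * (L : ℝ) ^ 3 * Real.sqrt u₀) (t₂ := 48 * (L : ℝ) ^ 3 * Real.sqrt u₀) (u := u₀)
    (fun w r g hle => swapBox_of_swapRingDeficit_le z u₀ w r g hle)
  have hzero : (Measure.pi fun _ : Fin 4 => haarProbability SU2).real {C : Fin 4 → SU2 |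
        (∀ μ ν : Fin 3, frobNorm (((C (Fin.castSucc μ) * C (Fin.castSucc ν) : SU2) : Matrix (Fin 2) (Fin 2) ℂ) -
          ((C (Fin.castSucc ν) * C (Fin.castSucc μ) : SU2) : Matrix (Fin 2) (Fin 2) ℂ)) ≤ 52 * (L : ℝ) ^ 3 * Real.sqrt u₀) ∧
        ∀ μ : Fin 3, frobNorm (((C (Fin.last 3) * C (Fin.castSucc (Equiv.swap (0 : Fin 3) 1 μ)) : SU2) : Matrix (Fin 2) (Fin 2) ℂ) -
          ((centreElem (z μ) * C (Fin.castSucc μ) * C (Fin.last 3) : SU2) : Matrix (Fin 2) (Fin 2) ℂ)) ≤ 52 * (L : ℝ) ^ 3 * Real.sqrt u₀} = 0 := by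
    rw [measureReal_def, hE _ hs, ENNReal.toReal_zero]
  have hreal : (ringMeasure L).real {P | swapRingDeficit L z P ≤ u₀} = 0 :=
    le_antisymm (hF.trans (by rw [hzero, zero_mul])) measureReal_nonneg
  exact (measureReal_eq_zero_iff (measure_ne_top _ _)).1 hreal

/-- ★★ **Odd seam sectors are exponentially negligible**: for `z 0 ≠ z 1` there is `u₀(L) > 0` with `∫e^{−bF^S_z}dμ_L ≤ e^{−b·u₀}` for every `b ≥ 0`
(`F^S_z > u₀` almost everywhere). [cite: tHooft1979] [cite: Luscher1983, §2] -/
theorem swap_oddSector_integral_exp_le (z : Fin 3 → Bool) (h01 : z 0 ≠ z 1) :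
    ∃ u₀ : ℝ, 0 < u₀ ∧ ∀ b : ℝ, 0 ≤ b →
      ∫ P, Real.exp (-(b * swapRingDeficit L z P)) ∂(ringMeasure L) ≤ Real.exp (-(b * u₀)) := by
  haveI := isProbabilityMeasure_ringMeasure (L := L)
  obtain ⟨u₀, hu₀, h⟩ := swap_oddSector_measure_eq_zero (L := L) z h01
  refine ⟨u₀, hu₀, fun b hb => ?_⟩
  have hae : ∀ᵐ P ∂(ringMeasure L), Real.exp (-(b * swapRingDeficit L z P)) ≤ Real.exp (-(b * u₀)) := by
    filter_upwards [measure_eq_zero_iff_ae_notMem.1 (h u₀ le_rfl)] with P hP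
    have hP' : u₀ < swapRingDeficit L z P := lt_of_not_ge hP
    exact Real.exp_le_exp.2 (by nlinarith)
  calc ∫ P, Real.exp (-(b * swapRingDeficit L z P)) ∂(ringMeasure L)
      ≤ ∫ _P, Real.exp (-(b * u₀)) ∂(ringMeasure L) :=
        integral_mono_ae ((integrable_const _).mono' (Real.measurable_exp.comp
            ((measurable_const.mul (measurable_swapRingDeficit z)).neg)).aestronglyMeasurable
          (ae_of_all _ fun P => by
            rw [Real.norm_eq_abs, abs_of_pos (Real.exp_pos _)]
            exact Real.exp_le_exp.2 (by nlinarith [swapRingDeficit_nonneg (L := L) z P])))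
          (integrable_const _) hae
    _ = Real.exp (-(b * u₀)) := by simp

/-! ## §3 The classes `z 2 = 1`: subleading by `√u` -/

omit [NeZero L] in
/-- `(√u)⁸ · ((√u)³)^{6L⁴−3} = u^{9L⁴−1}·√u` for `u ≥ 0`. [folklore] -/
theorem sqrt_pow_eight_mul_pow (hL : 1 ≤ L) {u : ℝ} (hu : 0 ≤ u) :
    Real.sqrt u ^ 8 * (Real.sqrt u ^ 3) ^ (6 * L ^ 4 - 3) = u ^ (9 * L ^ 4 - 1) * Real.sqrt u := by
  have h8 : Real.sqrt u ^ 8 = Real.sqrt u ^ 7 * Real.sqrt u := by ring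
  rw [h8, mul_right_comm, sqrt_pow_seven_mul_pow hL hu]

/-- ★★ **The `z 2 = 1` seam sectors are subleading by `√u`**: `μ_L{F^S_z ≤ u} ≤ C_L·u^{9L⁴−1}·√u` for `0 < u ≤ u₀(L)` — the four-leader event costs `t⁸`
(w2 g54's ✓`haar_pi_sigmaTwisted_minus_le` via fcl-p3's ✓`haar_signedEvent_minus_le`) instead of `t⁷`, through the same box/Fubini/ball chain as
✓`swap_sectorVolume_ceiling`. [cite: tHooft1979] [cite: Luscher1983, §2] [cite: Chatterjee2016, Lemma 9.3] -/
theorem swap_minusSector_volume_le (z : Fin 3 → Bool) (h2 : z 2 = true) :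
    ∃ C : ℝ, 0 ≤ C ∧ ∃ u₀ : ℝ, 0 < u₀ ∧ ∀ u : ℝ, 0 < u → u ≤ u₀ →
      (ringMeasure L).real {P | swapRingDeficit L z P ≤ u} ≤ C * (u ^ (9 * L ^ 4 - 1) * Real.sqrt u) := by
  have hc := coneConst_pos
  have hL1 : 1 ≤ L := NeZero.one_le
  have hL : (0 : ℝ) < L := Nat.cast_pos.2 (NeZero.pos L)
  have hA : (0 : ℝ) < 52 * (L : ℝ) ^ 3 := by positivity
  refine ⟨8192 * coneConst ^ 3 * (52 * (L : ℝ) ^ 3) ^ 8 * (4 * (48 * (L : ℝ) ^ 3) ^ 3) ^ (6 * L ^ 4 - 3), by positivity,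
    (1 / (52 * (L : ℝ) ^ 3)) ^ 2, by positivity, fun u hu hu₀ => ?_⟩
  set s : ℝ := 52 * (L : ℝ) ^ 3 * Real.sqrt u with hs_def
  set t₂ : ℝ := 48 * (L : ℝ) ^ 3 * Real.sqrt u with ht₂_def
  have hsu : 0 < Real.sqrt u := Real.sqrt_pos.2 hu
  have hs : 0 < s := by positivity
  have ht₂ : 0 < t₂ := by positivity
  have hs1 : s ≤ 1 := by
    have h1 : Real.sqrt u ≤ 1 / (52 * (L : ℝ) ^ 3) := by
      rw [← Real.sqrt_sq (div_pos one_pos hA).le]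
      exact Real.sqrt_le_sqrt hu₀
    calc s = 52 * (L : ℝ) ^ 3 * Real.sqrt u := rfl
      _ ≤ 52 * (L : ℝ) ^ 3 * (1 / (52 * (L : ℝ) ^ 3)) := mul_le_mul_of_nonneg_left h1 hA.le
      _ = 1 := mul_div_cancel₀ _ hA.ne'
  have hF := ringMeasure_real_swapDeficit_le_le_box_of_box (L := L) z
    (fun x : Site 3 L => centreElem (Bool.xor (z 0 && decide (x 0 ≠ 0)) (Bool.xor (z 1 && decide (x 1 ≠ 0)) (z 2 && decide (x 2 ≠ 0)))))
    (fun μ : Fin 3 => centreElem (z μ)) (s := s) (t₂ := t₂) (u := u)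
    (fun w r g hle => swapBox_of_swapRingDeficit_le z u w r g hle)
  have hEs : (Measure.pi fun _ : Fin 4 => haarProbability SU2).real {C : Fin 4 → SU2 |
        (∀ μ ν : Fin 3, frobNorm (((C (Fin.castSucc μ) * C (Fin.castSucc ν) : SU2) : Matrix (Fin 2) (Fin 2) ℂ) -
          ((C (Fin.castSucc ν) * C (Fin.castSucc μ) : SU2) : Matrix (Fin 2) (Fin 2) ℂ)) ≤ s) ∧
        ∀ μ : Fin 3, frobNorm (((C (Fin.last 3) * C (Fin.castSucc (Equiv.swap (0 : Fin 3) 1 μ)) : SU2) : Matrix (Fin 2) (Fin 2) ℂ) -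
          ((centreElem (z μ) * C (Fin.castSucc μ) * C (Fin.last 3) : SU2) : Matrix (Fin 2) (Fin 2) ℂ)) ≤ s} ≤ 8192 * coneConst ^ 3 * s ^ 8 := by
    rw [measureReal_def]
    exact ENNReal.toReal_le_of_le_ofReal (by positivity) (haar_signedEvent_minus_le z h2 hs hs1)
  have hball : ballVol t₂ ^ (6 * L ^ 4 - 3) ≤ (4 * t₂ ^ 3) ^ (6 * L ^ 4 - 3) :=
    pow_le_pow_left₀ (ballVol_nonneg _) (ballVol_le_four_mul_cube ht₂) _
  have hkey := sqrt_pow_eight_mul_pow hL1 hu.le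
  calc (ringMeasure L).real {P | swapRingDeficit L z P ≤ u}
      ≤ _ := hF
    _ ≤ 8192 * coneConst ^ 3 * s ^ 8 * (4 * t₂ ^ 3) ^ (6 * L ^ 4 - 3) :=
        mul_le_mul hEs hball (pow_nonneg (ballVol_nonneg _) _) (by positivity)
    _ = 8192 * coneConst ^ 3 * (52 * (L : ℝ) ^ 3) ^ 8 * (4 * (48 * (L : ℝ) ^ 3) ^ 3) ^ (6 * L ^ 4 - 3) *
          (Real.sqrt u ^ 8 * (Real.sqrt u ^ 3) ^ (6 * L ^ 4 - 3)) := by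
        rw [hs_def, ht₂_def, mul_pow (52 * (L : ℝ) ^ 3), mul_pow (48 * (L : ℝ) ^ 3), ← mul_assoc (4 : ℝ), mul_pow (4 * _)]
        ring
    _ = 8192 * coneConst ^ 3 * (52 * (L : ℝ) ^ 3) ^ 8 * (4 * (48 * (L : ℝ) ^ 3) ^ 3) ^ (6 * L ^ 4 - 3) *
          (u ^ (9 * L ^ 4 - 1) * Real.sqrt u) := by rw [hkey]

/-- ★★ **The `z 2 = 1` seam sectors are subleading by `√β` in the Laplace transform**: for every `β > 0`,
`∫e^{−βF^S_z}dμ_L ≤ C_L·(N! + (N+1)!)/(2β^N√β) + u₀^{−(N+1)}(N+1)!/β^{N+1}`, `N = 9L⁴ − 1` — against the leading classes' `β^{−N}`.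
[cite: tHooft1979] [cite: Luscher1983, §2] -/
theorem swap_minusSector_integral_exp_le (z : Fin 3 → Bool) (h2 : z 2 = true) :
    ∃ C : ℝ, 0 ≤ C ∧ ∃ u₀ : ℝ, 0 < u₀ ∧ ∀ β : ℝ, 0 < β →
      ∫ P, Real.exp (-(β * swapRingDeficit L z P)) ∂(ringMeasure L) ≤
        C * ((9 * L ^ 4 - 1) ! + (9 * L ^ 4 - 1 + 1) !) / (2 * β ^ (9 * L ^ 4 - 1) * Real.sqrt β) +
          (u₀ ^ (9 * L ^ 4 - 1 + 1))⁻¹ * (9 * L ^ 4 - 1 + 1) ! / β ^ (9 * L ^ 4 - 1 + 1) := by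
  haveI := isProbabilityMeasure_ringMeasure (L := L)
  obtain ⟨C, hC, u₀, hu₀, hvol⟩ := swap_minusSector_volume_le (L := L) z h2
  refine ⟨C, hC, u₀, hu₀, fun β hβ => ?_⟩
  exact integral_exp_neg_mul_le_of_pow_sqrt_volume (μ := ringMeasure L) (swapRingDeficit L z) (measurable_swapRingDeficit z)
    (swapRingDeficit_nonneg (L := L) z) hC hu₀ (9 * L ^ 4 - 1) (fun s hs hsu => by rw [mul_assoc]; exact hvol s hs hsu) hβ

end Summit.QuantumFields.YangMills.Theorems.SwapVirialDeficit.SwapRing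

end
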